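import Summits.AtomisticToContinuum.HydrodynamicLimit.Theorems.DensityCap.Negative.MollifiedDensity
import Summits.AtomisticToContinuum.HydrodynamicLimit.Theorems.DensityCap.Negative.KernelMass
import Literature.Analysis.FunctionSpaces.TorusSpaceTime
import Literature.Analysis.FunctionSpaces.TorusSpaceTimeFields
import Literature.Analysis.FluidPDE.HardSpherePhaseSpaceProofs
import HarnessLib

/-!
# Joint modulus of continuity of the Euler density and its cone averages
# (`stub_eulerDensityModulus`, stub B of the crux line `lipschitz-clock-free-past-cap`,
# `JParityClosure.DensityCap`, stmt-AtomisticToContinuum-13082)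

The PDE-side continuity input of the line. For a density field `ρ : ℝ → 𝕋³ → ℝ` that is jointly
smooth on `[0, T) × 𝕋³` (`Torus.IsSmoothSpaceTimeOn (Ico 0 T) ρ`, e.g. the density of a classical
hard-sphere Euler solution) and a time `t < T`, for every `η > 0` there are scales
`0 < r₀ ≤ 1/2` and `τ₀ > 0` such that

* (i) for every radius `0 < r < r₀`, every `s ∈ [0, t]` and every centre `x`, the cone average
  `∫ cone r y x · ρ s y dy` is at most `ρ s x + η`;
* (ii) `|ρ s x − ρ s' x'| ≤ η` whenever `s, s' ∈ [0, t]`, `|s − s'| ≤ τ₀` and the MINIMAL-IMAGE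
  distance of `x, x'` is at most `r₀`.

Proof. Only continuity of `ρ` is used. The space–time lift `stLift ρ (s, y) = ρ s (proj y)` is
continuous on `[0, T) × ℝ³`, hence uniformly continuous on the compact set
`[0, t] × closedBall 0 2` (Heine–Cantor). Two points `x, x'` of the torus at minimal-image
distance `d` have representatives `reprSym x` and `reprSym x + reprSym (x' − x)` in that ball at
Euclidean distance exactly `d`; this gives (ii) with `τ₀ = r₀ = δ/2 ∧ 1/2` for the
uniform-continuity scale `δ` of `η`. For (i), pointwise `cone r y x · ρ s y ≤ cone r y x · (ρ s x + η)`
(the kernel vanishes unless `d(y, x) < r < r₀`, where (ii) at `s' = s` applies, and is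
nonnegative), and `∫ cone r y x dy = coneMass r = 1` for `r ≤ 1/2` (`integral_cone`,
`coneMass_eq_one`).

References: elementary (Heine–Cantor on a compact space–time cylinder); the cone kernel and its
unit mass are those of the crux vocabulary (`DensityCapNegative.cone`, `coneMass_eq_one`).
-/

noncomputable section

namespace Summit.AtomisticToContinuum.HydrodynamicLimit.Theorems

open MeasureTheory Set
open Literature.MathematicalPhysics.KineticTheory Literature.Analysis.FluidPDE
open Literature.Analysis.FunctionSpaces (Torus.IsSmoothSpaceTimeOn Torus.stLift Torus.stLift_apply
  Torus.proj Torus.proj_add Torus.continuous_slice_of_continuousOn_stLift)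
open Summit.AtomisticToContinuum.HydrodynamicLimit.Theorems.DensityCapNegative
  (cone coneMass cone_nonneg cone_le integral_cone coneMass_eq_one)

/-! ## Geometry of the minimal-image distance and of the cone kernel -/

/-- The symmetric representative of a point of `𝕋³` has Euclidean norm at most `1`
(in fact `≤ √3 / 2`, `Torus.norm_reprSym_le_holds`). -/
theorem densMod_norm_reprSym_le_one (x : T3) : ‖Torus.reprSym x‖ ≤ 1 := by
  have h : ‖Torus.reprSym x‖ ≤ Real.sqrt (Fintype.card (Fin 3)) / 2 :=
    Torus.norm_reprSym_le_holds x
  have h3 : Real.sqrt (Fintype.card (Fin 3) : ℝ) ≤ 2 := by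
    rw [Fintype.card_fin, Real.sqrt_le_left (by norm_num)]
    norm_num
  linarith

/-- The cone kernel is continuous in the particle position (the minimal-image distance is
jointly continuous, `Torus.continuous_euclidDist`). -/
theorem densMod_continuous_cone (r : ℝ) (x : T3) : Continuous fun y : T3 => cone r y x := by
  have hd : Continuous fun y : T3 => Torus.euclidDist y x := by
    simpa only [Function.comp_def, id_eq] using
      Torus.continuous_euclidDist.comp (continuous_id.prodMk continuous_const)
  unfold cone
  exact continuous_const.mul ((continuous_const.sub (hd.div_const r)).max continuous_const)

/-- The cone kernel is symmetric (the minimal-image distance is). -/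
theorem densMod_cone_comm (r : ℝ) (x y : T3) : cone r y x = cone r x y := by
  unfold cone
  rw [Torus.euclidDist_comm]

/-- The cone kernel of radius `r > 0` vanishes at minimal-image distance `≥ r`. -/
theorem densMod_cone_eq_zero {r : ℝ} (hr : 0 < r) {x y : T3} (h : r ≤ Torus.euclidDist y x) :
    cone r y x = 0 := by
  unfold cone
  have h1 : 1 ≤ Torus.euclidDist y x / r := by rwa [le_div_iff₀ hr, one_mul]
  rw [max_eq_right (by linarith), mul_zero]

/-- The cone kernel of radius `0 < r ≤ 1/2` has unit mass in the particle variable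
(`integral_cone`, `coneMass_eq_one`). -/
theorem densMod_integral_cone_eq_one {r : ℝ} (hr : 0 < r) (hr2 : r ≤ 1 / 2) (x : T3) :
    ∫ y, cone r y x = 1 := by
  have h : (fun y => cone r y x) = fun y => cone r x y := funext fun y => densMod_cone_comm r x y
  rw [h, integral_cone r x, coneMass_eq_one hr hr2]

/-! ## The joint modulus of continuity (Heine–Cantor on `[0, t] × closedBall 0 2`) -/

/-- **Joint uniform continuity in the minimal-image metric.** If the space–time lift of
`ρ : ℝ → 𝕋³ → ℝ` is continuous on `[0, T) × ℝ³` and `t < T`, then for every `η > 0` there is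
`δ > 0` with `|ρ s x − ρ s' x'| < η` for all `s, s' ∈ [0, t]` with `|s − s'| < δ` and all `x, x'` at
minimal-image distance `< δ` (uniform continuity of the lift on the compact
`[0, t] × closedBall 0 2`, read at the representatives `reprSym x`, `reprSym x + reprSym (x' − x)`). -/
theorem densMod_modulus {T : ℝ} {ρ : ℝ → T3 → ℝ}
    (hρ : ContinuousOn (Torus.stLift ρ) (Ico 0 T ×ˢ univ)) {t : ℝ} (ht : t < T) {η : ℝ}
    (hη : 0 < η) :
    ∃ δ : ℝ, 0 < δ ∧ ∀ s ∈ Icc 0 t, ∀ s' ∈ Icc 0 t, |s - s'| < δ →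
      ∀ x x' : T3, Torus.euclidDist x x' < δ → |ρ s x - ρ s' x'| < η := by
  have hKc : IsCompact (Icc 0 t ×ˢ Metric.closedBall (0 : EuclideanSpace ℝ (Fin 3)) 2) :=
    isCompact_Icc.prod (isCompact_closedBall 0 2)
  have hKS : Icc 0 t ×ˢ Metric.closedBall (0 : EuclideanSpace ℝ (Fin 3)) 2 ⊆ Ico 0 T ×ˢ univ :=
    prod_mono (Icc_subset_Ico_right ht) (subset_univ _)
  obtain ⟨δ, hδ, hU⟩ :=
    Metric.uniformContinuousOn_iff.1 (hKc.uniformContinuousOn_of_continuous (hρ.mono hKS)) η hη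
  refine ⟨δ, hδ, fun s hs s' hs' hss' x x' hxx' => ?_⟩
  have h1 : ((s, Torus.reprSym x) : ℝ × EuclideanSpace ℝ (Fin 3)) ∈
      Icc 0 t ×ˢ Metric.closedBall (0 : EuclideanSpace ℝ (Fin 3)) 2 := by
    refine mk_mem_prod hs ?_
    rw [Metric.mem_closedBall, dist_zero_right]
    linarith [densMod_norm_reprSym_le_one x]
  have h2 : ((s', Torus.reprSym x + Torus.reprSym (x' - x)) : ℝ × EuclideanSpace ℝ (Fin 3)) ∈
      Icc 0 t ×ˢ Metric.closedBall (0 : EuclideanSpace ℝ (Fin 3)) 2 := by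
    refine mk_mem_prod hs' ?_
    rw [Metric.mem_closedBall, dist_zero_right]
    calc ‖Torus.reprSym x + Torus.reprSym (x' - x)‖
        ≤ ‖Torus.reprSym x‖ + ‖Torus.reprSym (x' - x)‖ := norm_add_le _ _
      _ ≤ 1 + 1 := add_le_add (densMod_norm_reprSym_le_one x) (densMod_norm_reprSym_le_one _)
      _ = 2 := by norm_num
  have hdist : dist ((s, Torus.reprSym x) : ℝ × EuclideanSpace ℝ (Fin 3))
      (s', Torus.reprSym x + Torus.reprSym (x' - x)) < δ := by
    rw [Prod.dist_eq, max_lt_iff]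
    refine ⟨?_, ?_⟩
    · show dist s s' < δ
      rwa [Real.dist_eq]
    · show dist (Torus.reprSym x) (Torus.reprSym x + Torus.reprSym (x' - x)) < δ
      rw [dist_eq_norm, sub_add_cancel_left, norm_neg, ← Torus.euclidDist_eq,
        Torus.euclidDist_comm]
      exact hxx'
  have h := hU _ h1 _ h2 hdist
  rw [Real.dist_eq, Torus.stLift_apply, Torus.stLift_apply, Torus.proj_add, Torus.proj_reprSym,
    Torus.proj_reprSym, add_sub_cancel] at h
  exact h

/-! ## The stub -/

/-- **STUB B — the Euler-side modulus** of the line `lipschitz-clock-free-past-cap`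
(crux `JParityClosure.DensityCap`). For a density `ρ` jointly smooth on `[0, T) × 𝕋³` and
`t < T`: for every `η > 0` there are `0 < r₀ ≤ 1/2` and `τ₀ > 0` with
(i) `∫ cone r y x · ρ s y dy ≤ ρ s x + η` for all `0 < r < r₀`, `s ∈ [0, t]`, `x ∈ 𝕋³`, and
(ii) `|ρ s x − ρ s' x'| ≤ η` for `s, s' ∈ [0, t]`, `|s − s'| ≤ τ₀`, `d(x, x') ≤ r₀` (minimal-image
distance). Proof: `densMod_modulus` (Heine–Cantor) with `r₀ := δ/2 ∧ 1/2`, `τ₀ := δ/2`; for (i)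
the pointwise bound `cone · ρ s y ≤ cone · (ρ s x + η)` on the support `d(y, x) < r` of the
nonnegative kernel, integrated against its unit mass (`coneMass_eq_one`). -/
theorem stub_eulerDensityModulus {T : ℝ} {ρ : ℝ → T3 → ℝ}
    (hρ : Torus.IsSmoothSpaceTimeOn (Ico 0 T) ρ) {t : ℝ} (ht : t ∈ Ico 0 T) :
    ∀ η : ℝ, 0 < η → ∃ r₀ : ℝ, 0 < r₀ ∧ r₀ ≤ 1 / 2 ∧
      (∀ r : ℝ, 0 < r → r < r₀ → ∀ s ∈ Icc 0 t, ∀ x : T3, ∫ y, cone r y x * ρ s y ≤ ρ s x + η) ∧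
      ∃ τ₀ : ℝ, 0 < τ₀ ∧ ∀ s ∈ Icc 0 t, ∀ s' ∈ Icc 0 t, |s - s'| ≤ τ₀ →
        ∀ x x' : T3, Torus.euclidDist x x' ≤ r₀ → |ρ s x - ρ s' x'| ≤ η := by
  intro η hη
  have hcont : ContinuousOn (Torus.stLift ρ) (Ico 0 T ×ˢ univ) := hρ.continuousOn_stLift
  obtain ⟨δ, hδ, hmod⟩ := densMod_modulus hcont ht.2 hη
  have hδ2 : δ / 2 < δ := half_lt_self hδ
  have hr₀δ : min (δ / 2) (1 / 2) < δ := (min_le_left _ _).trans_lt hδ2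
  refine ⟨min (δ / 2) (1 / 2), lt_min (half_pos hδ) one_half_pos, min_le_right _ _, ?_,
    ⟨δ / 2, half_pos hδ, ?_⟩⟩
  · intro r hr hrr s hs x
    have hr2 : r ≤ 1 / 2 := hrr.le.trans (min_le_right _ _)
    have hrδ : r < δ := hrr.trans hr₀δ
    have hsT : s ∈ Ico 0 T := ⟨hs.1, hs.2.trans_lt ht.2⟩
    have hρc : Continuous (ρ s) := Torus.continuous_slice_of_continuousOn_stLift hcont hsT
    have hcc : Continuous fun y : T3 => cone r y x := densMod_continuous_cone r x
    have hpt : ∀ y, cone r y x * ρ s y ≤ cone r y x * (ρ s x + η) := by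
      intro y
      by_cases hyx : Torus.euclidDist y x < r
      · refine mul_le_mul_of_nonneg_left ?_ (cone_nonneg hr y x)
        have hxy : Torus.euclidDist x y < δ := by
          rw [Torus.euclidDist_comm]
          exact hyx.trans hrδ
        have hss : |s - s| < δ := by
          rw [sub_self, abs_zero]
          exact hδ
        have hb := hmod s hs s hs hss x y hxy
        rw [abs_lt] at hb
        linarith [hb.1]
      · rw [densMod_cone_eq_zero hr (not_lt.1 hyx), zero_mul, zero_mul]
    calc ∫ y, cone r y x * ρ s y ≤ ∫ y, cone r y x * (ρ s x + η) :=
          integral_mono (hcc.mul hρc).integrable_unitAddTorus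
            (hcc.mul continuous_const).integrable_unitAddTorus hpt
      _ = (∫ y, cone r y x) * (ρ s x + η) := integral_mul_const _ _
      _ = ρ s x + η := by rw [densMod_integral_cone_eq_one hr hr2 x, one_mul]
  · intro s hs s' hs' hss' x x' hxx'
    exact (hmod s hs s' hs' (hss'.trans_lt hδ2) x x' (hxx'.trans_lt hr₀δ)).le

end Summit.AtomisticToContinuum.HydrodynamicLimit.Theorems

end
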